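import Mathlib

/-!
# Self-converse gadgets are capacity gadgets: the graph words of `π` form a zero-error code (support file)

Item `stmt-MatrixMultiplication-14308` (`FourierTwoFamiliesModP.PrimeTwoFamilies`, CKSU 2005 Conj. 4.7 with
prime cyclic hosts), line `Sketch` (cycle c1, capacity-gadget skeleton `Cruxes/PrimeTwoFamilies/Lines/Sketch.lean`),
registered stub `stub_selfConverse`.

A *gadget* at level `m` is a list of direct pairs `(P σ, Q σ)`, `σ : Fin r`, of subsets of `ℤ/m`
(direct: `(x - x') + (y - y') = 0` with `x, x' ∈ P σ`, `y, y' ∈ Q σ` forces `x = x'`, `y = y'`).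
Letter `σ` is *strongly separated towards* `τ` when every cross difference `q - p` (`p ∈ P σ`, `q ∈ Q τ`)
avoids every diagonal difference `q' - p'` (`p' ∈ P c`, `q' ∈ Q c`).  The hypothesis (self-converse
gadgets) provides, for every `ε > 0` and beyond every `m₀`, a level `m` with `r ≥ m ^ (1 - ε)` letters of
co-volume `|P σ| |Q σ| ≥ m ^ (1 - ε)` and a map `π` such that every ordered pair of distinct letters is
separated either directly or after applying `π`.  The conclusion (capacity gadgets) asks for a zero-error
code `W` of words `Fin L → Fin r`, `1 ≤ L`, every ordered pair of distinct words being separated in some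
coordinate, with `|W| ≥ (m ^ L) ^ (1/2 - ε)`.

Proof: apply the hypothesis at `max m₀ 1` (so `m ≥ 1`), keep `m, r, P, Q`, take `L = 2` and let `W` be
the set of graph words `σ ↦ (σ, π σ)`.  These are pairwise distinct, so `|W| = r`; two distinct graph
words come from letters `σ ≠ τ`, which are separated at coordinate `0` (values `σ, τ`) or at coordinate
`1` (values `π σ, π τ`).  Finally `(m ^ 2) ^ (1/2 - ε) = m ^ (1 - 2ε) ≤ m ^ (1 - ε) ≤ r` as `m ≥ 1`.
-/

-- single-conjunct summit: the mandated namespace repeats `MatrixMultiplication` (summit = sub-problem).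
set_option linter.dupNamespace false

namespace Summit.MatrixMultiplication.MatrixMultiplication.Theorems.PrimeTwoFamilies.CapacityLift

open Finset

/-- **Self-converse gadgets are capacity gadgets.**  If for every `ε > 0` and beyond every `m₀` there
is a gadget `(P σ, Q σ)_{σ : Fin r}` of direct pairs in `ℤ/m` with `r ≥ m ^ (1 - ε)` letters, each of
co-volume `≥ m ^ (1 - ε)`, together with a map `π` separating every ordered pair of distinct letters
either directly or after `π`, then for every `ε > 0` and beyond every `m₀` there is such a gadget
carrying a zero-error code `W` of words of some length `L ≥ 1` (distinct words separated in some
coordinate) of size `|W| ≥ (m ^ L) ^ (1/2 - ε)`.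

Proof idea: take the level given by the hypothesis at `max m₀ 1`, `L = 2`, and `W` the graph words
`σ ↦ (σ, π σ)`; they are pairwise distinct (`|W| = r`), distinct graph words are separated at
coordinate `0` or `1` by the hypothesis on `π`, and `(m ^ 2) ^ (1/2 - ε) = m ^ (1 - 2ε) ≤ m ^ (1 - ε) ≤ r`
because `m ≥ 1`. -/
theorem stub_selfConverse
    (h : ∀ ε : ℝ, 0 < ε → ∀ m₀ : ℕ, ∃ m ≥ m₀, ∃ r : ℕ, ∃ P Q : Fin r → Finset (ZMod m),
      ∃ π : Fin r → Fin r,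
      (∀ c : Fin r, ∀ x ∈ P c, ∀ x' ∈ P c, ∀ y ∈ Q c, ∀ y' ∈ Q c,
          (x - x') + (y - y') = 0 → x = x' ∧ y = y') ∧
      (∀ σ τ : Fin r, σ ≠ τ →
        (∀ p ∈ P σ, ∀ q ∈ Q τ, ∀ c : Fin r, ∀ p' ∈ P c, ∀ q' ∈ Q c, q - p ≠ q' - p') ∨
        (∀ p ∈ P (π σ), ∀ q ∈ Q (π τ), ∀ c : Fin r, ∀ p' ∈ P c, ∀ q' ∈ Q c, q - p ≠ q' - p')) ∧
      (m : ℝ) ^ (1 - ε) ≤ (r : ℝ) ∧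
      ∀ c : Fin r, (m : ℝ) ^ (1 - ε) ≤ (((P c).card * (Q c).card : ℕ) : ℝ)) :
    ∀ ε : ℝ, 0 < ε → ∀ m₀ : ℕ, ∃ m ≥ m₀, ∃ r L : ℕ, ∃ P Q : Fin r → Finset (ZMod m),
      ∃ W : Finset (Fin L → Fin r),
      (∀ c : Fin r, ∀ x ∈ P c, ∀ x' ∈ P c, ∀ y ∈ Q c, ∀ y' ∈ Q c,
          (x - x') + (y - y') = 0 → x = x' ∧ y = y') ∧
      (∀ i ∈ W, ∀ k ∈ W, i ≠ k → ∃ t : Fin L,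
        ∀ p ∈ P (i t), ∀ q ∈ Q (k t), ∀ c : Fin r, ∀ p' ∈ P c, ∀ q' ∈ Q c, q - p ≠ q' - p') ∧
      1 ≤ L ∧
      ((m : ℝ) ^ (L : ℝ)) ^ (1 / 2 - ε) ≤ (W.card : ℝ) ∧
      ∀ c : Fin r, (m : ℝ) ^ (1 - ε) ≤ (((P c).card * (Q c).card : ℕ) : ℝ) := by
  intro ε hε m₀
  -- ask for a level `m ≥ max m₀ 1`, so that `1 ≤ m` and real powers of `m` are monotone in the exponent
  obtain ⟨m, hm, r, P, Q, π, hdirect, hsep, hr, hvol⟩ := h ε hε (max m₀ 1)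
  have hm1 : (1 : ℝ) ≤ m := by exact_mod_cast le_of_max_le_right hm
  -- the graph words `σ ↦ (σ, π σ)` of `π`, read as words of length two, are pairwise distinct
  have hinj : Function.Injective (fun σ : Fin r => (![σ, π σ] : Fin 2 → Fin r)) := by
    intro σ τ hστ
    simpa using congrFun hστ 0
  refine ⟨m, le_of_max_le_left hm, r, 2, P, Q,
    Finset.univ.image (fun σ : Fin r => (![σ, π σ] : Fin 2 → Fin r)), hdirect, ?_, by norm_num, ?_, hvol⟩
  · -- code property: two distinct graph words come from distinct letters `σ ≠ τ`, which are separated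
    -- either directly (coordinate `0`, values `σ, τ`) or after `π` (coordinate `1`, values `π σ, π τ`)
    intro i hi k hk hik
    obtain ⟨σ, -, rfl⟩ := Finset.mem_image.mp hi
    obtain ⟨τ, -, rfl⟩ := Finset.mem_image.mp hk
    have hστ : σ ≠ τ := by
      rintro rfl
      exact hik rfl
    rcases hsep σ τ hστ with hst | hst
    · exact ⟨0, hst⟩
    · exact ⟨1, hst⟩
  · -- size: `|W| = r ≥ m ^ (1 - ε) ≥ m ^ (1 - 2ε) = (m ^ 2) ^ (1/2 - ε)`
    rw [Finset.card_image_of_injective _ hinj, Finset.card_univ, Fintype.card_fin]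
    calc ((m : ℝ) ^ ((2 : ℕ) : ℝ)) ^ (1 / 2 - ε)
        = (m : ℝ) ^ (((2 : ℕ) : ℝ) * (1 / 2 - ε)) := (Real.rpow_mul (by positivity) _ _).symm
      _ = (m : ℝ) ^ (1 - 2 * ε) := by
          congr 1
          push_cast
          ring
      _ ≤ (m : ℝ) ^ (1 - ε) := Real.rpow_le_rpow_of_exponent_le hm1 (by linarith)
      _ ≤ r := hr

end Summit.MatrixMultiplication.MatrixMultiplication.Theorems.PrimeTwoFamilies.CapacityLift
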